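/-
Copyright (c) 2026 the pub-hodgecm-mathlib formalisation cell (harness21).  Prover seat hodgecm-mathlib-K2E3-p06 (g2), Track B «K2-LIT» ∕ h413,
ENGINE E3 unit U4 «Keys», SIGS-TABLE row #6 `sig_K2E3IrregularReducibleCaseThree` — analytic letter hKP, brick F3 (the zeta integral fibres over the skew line).
-/
import Summits.HodgeConjecture.HodgeConjecture.Theorems.K2E3SkewLineIntegrable                    -- ★ brick F2 (this seat): integrability, truncations, `χ⁻(l)`-scaling
import Summits.HodgeConjecture.HodgeConjecture.Theorems.F0P3cStCharTSInvolutionRingPolarSliceShells  -- ★ B2 (i): substitution `y = s η` on `R⁻`, `χ⁻(s)·(nrm s)⁻¹ = (√nrm s)⁻¹`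
import Mathlib.MeasureTheory.Integral.Prod
import HarnessLib

/-!
# K2 · E3 · U4 «Keys», row #6 — brick F3: the additive zeta integral `∫_E g_T(x) χ̃(x) ‖x‖⁻¹ dx` of the test function `g_T(x) = Φ(Re x) · 𝟙[‖Im x‖ ≤ T]` FIBRES over
# the skew line — `= ∫_{E⁺} Φ(s) χ̃(s) (√‖s‖)⁻¹ · J(T/‖s‖) ds` with `J(T') = ∫_{‖η‖ ≤ T'} ‖1+η‖⁻¹ χ̃(1+η) dη` (polar coordinates
# `x = s(1+η)` of ★ B2) [Keys1984 §5; Tate1950 §2.2; WeilBNT1967 VII §2]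

Cell `pub/hodgecm-mathlib` (D-0151), HCML Track B «K2-LIT», crux H413 = `stmt-HodgeConjecture-24833` (lane `--supports … --as helper`), route
HCCMUnconditional; socket `sig_K2E3IrregularReducibleCaseThree` (U4-c) of `Cruxes/H413/Lines/K2_E3_EllipticInputsSigs_U4Keys.lean`.
THEOREMS ONLY (0 def ∕ 0 instance ∕ 0 notation ∕ 0 sorry); ★-only imports.

FRAME: that of ★ brick F2 (`E` a non-archimedean local field, `σ` a continuous isometric involution, `2 ∈ Eˣ`, `E^± = fixedPart ∕ skewPart σ`, regular Haar measures
`μ⁺, μ⁻`, the Haar measure `μ_E := (μ⁺ ⊗ μ⁻) ∘ ringDecomp⁻¹` of `E`), a bounded measurable MULTIPLICATIVE `D : E → ℂ` (`D(ab) = D a · D b`; for hKP: the extension by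
zero `χ̃₁` of the character `χ₁`), and a bounded measurable `Φ : E → ℂ` vanishing near `0` and off a ball (for hKP: `Φ(a) = ψ_T(−a)𝟙_B(a) − ψ_T(−c₀a)𝟙_B(c₀a)`).
The zeta integral of Tate's Fubini trick at `s = 0` (★ brick F1) is, for the «units measure» `d×x = ‖x‖⁻¹dx` (★ `tateZeta_unitsMeasure`), the ADDITIVE integral
`Z(g_T, χ, 0) = ∫_E g_T χ̃ ‖·‖⁻¹ dμ_E`; this file computes it in the polar coordinates `x = s(1 + η)` of ★ B2.
* §1 `measure_singleton_zero_fixedPart` (`μ⁺{0} = 0`: scale by a fixed unit of module `≠ 1`), `re_fibre ∕ im_fibre` (`Re(s(1+η)) = s`, `Im(s(1+η)) = sη`),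
  `normAbs_two_mul_normAbs_fixed_le` (`‖2‖‖s‖ ≤ ‖s + y‖`);
* §2 **`integral_truncTest_mul_eq_integral_fixedPart`** — THE FIBRATION: for every `T ≥ 0`,
  `∫_E Φ(Re x) 𝟙[‖Im x‖ ≤ T] · D(x) ‖x‖⁻¹ dμ_E = ∫_{E⁺} Φ(s) D(s) (√‖s‖)⁻¹ · J_D(T/‖s‖) dμ⁺(s)`, `J_D(T') = ∫ 𝟙_{‖η‖ ≤ T'} (‖1+η‖⁻¹ • D(1+η)) dμ⁻`
  (Fubini on `E⁺ × E⁻`, ★ `integral_eq_skewModulus_smul_integral_comp_smulSkew` fibrewise at the unit `s`, ★ `skewModulus_mul_inv_nrm`);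
* (the limit `T_k → ∞`, by dominated convergence over `E⁺`, is brick F3b `K2E3SkewLineZetaLimit`.)
HONEST LABEL: HC_CM is proved only modulo the 7 printed citations (2 remaining named inputs: hLiu418 = `stmt-HodgeConjecture-24832`, h413 =
`stmt-HodgeConjecture-24833`) until rung 0 closes; count-neutral analytic plumbing (no socket paid here).

## References
* [Keys1984] D. Keys, *Principal series representations of special unitary groups over local fields*, Compositio Math. 51 (1984), §5.
* [Tate1950] J. Tate, *Fourier analysis in number fields and Hecke's zeta-functions* (1950), §2.2 Lemma 2.2.5, §2.4.
* [WeilBNT1967] A. Weil, *Basic Number Theory* (1967), Ch. I §2, Ch. VII §2 (polar decomposition of measures).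
-/

set_option autoImplicit false
-- the mandated namespace has the single-problem summit's repeated segment (`HodgeConjecture.HodgeConjecture`)
set_option linter.dupNamespace false

noncomputable section

open scoped NNReal ENNReal Topology Pointwise
open MeasureTheory Filter Set
open Literature.NumberTheory.GaloisRepresentations.IsNonarchimedeanLocalField
open Literature.NumberTheory.Automorphic
open Literature.NumberTheory.Automorphic.UnitaryGroup.HeisRing
open Summit.HodgeConjecture.HodgeConjecture.Cruxes.H413.F0P3cStCharTSInvolutionRingPolarSliceShells
open Summit.HodgeConjecture.HodgeConjecture.Cruxes.H413.K2E3SkewLineIntegrable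

namespace Summit.HodgeConjecture.HodgeConjecture.Cruxes.H413.K2E3SkewLineZetaFibration

variable {E : Type*} [Field E] [ValuativeRel E] [TopologicalSpace E] [IsNonarchimedeanLocalField E]
  (σ : E →+* E) (hσ : ∀ x, σ (σ x) = x) (hσc : Continuous σ) [Invertible (2 : E)]
  (hσn : ∀ x, normAbs E (σ x) = normAbs E x)

/-! ## §1 Preliminaries: the fibre coordinates, compact balls, `μ⁺{0} = 0` -/

section Prelim

omit [ValuativeRel E] [TopologicalSpace E] [IsNonarchimedeanLocalField E] in
/-- `Re(s + s η) = s` for `s` fixed, `η` skew: `½((s + sη) + σ(s + sη)) = s`. [cite: WeilBNT1967, Ch. VII §2] -/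
theorem re_fibre {s η : E} (hs : σ s = s) (hη : σ η = -η) : ⅟(2 : E) * ((s + s * η) + σ (s + s * η)) = s := by
  have h2 : (⅟(2 : E)) * 2 = 1 := invOf_mul_self _
  rw [map_add, map_mul, hs, hη]; linear_combination s * h2

omit [ValuativeRel E] [TopologicalSpace E] [IsNonarchimedeanLocalField E] in
/-- `Im(s + s η) = s η` for `s` fixed, `η` skew: `½((s + sη) − σ(s + sη)) = sη`. [cite: WeilBNT1967, Ch. VII §2] -/
theorem im_fibre {s η : E} (hs : σ s = s) (hη : σ η = -η) : ⅟(2 : E) * ((s + s * η) - σ (s + s * η)) = s * η := by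
  have h2 : (⅟(2 : E)) * 2 = 1 := invOf_mul_self _
  rw [map_add, map_mul, hs, hη]; linear_combination (s * η) * h2

omit [ValuativeRel E] [TopologicalSpace E] [IsNonarchimedeanLocalField E] in
/-- `Re(a + y) = a` for `a` fixed, `y` skew. [cite: WeilBNT1967, Ch. VII §2] -/
theorem re_add {a y : E} (ha : σ a = a) (hy : σ y = -y) : ⅟(2 : E) * ((a + y) + σ (a + y)) = a := by
  have h2 : (⅟(2 : E)) * 2 = 1 := invOf_mul_self _
  rw [map_add, ha, hy]; linear_combination a * h2

omit [ValuativeRel E] [TopologicalSpace E] [IsNonarchimedeanLocalField E] in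
/-- `Im(a + y) = y` for `a` fixed, `y` skew. [cite: WeilBNT1967, Ch. VII §2] -/
theorem im_add {a y : E} (ha : σ a = a) (hy : σ y = -y) : ⅟(2 : E) * ((a + y) - σ (a + y)) = y := by
  have h2 : (⅟(2 : E)) * 2 = 1 := invOf_mul_self _
  rw [map_add, ha, hy]; linear_combination y * h2

omit [Invertible (2 : E)] in
/-- **Closed balls of `E` are compact** (`{‖x‖ ≤ R} ⊆ 𝔭^{−k}` for `q^k > R`, closed by continuity of `‖·‖`). [cite: WeilBNT1967, Ch. I §2] -/
theorem isCompact_setOf_normAbs_le (R : ℝ≥0) : IsCompact {x : E | normAbs E x ≤ R} := by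
  obtain ⟨k, hk⟩ := pow_unbounded_of_one_lt R (one_lt_residueFieldCard_nnreal (F := E))
  have hsub : {x : E | normAbs E x ≤ R} ⊆ primePowBall E (-(k : ℤ)) := fun x hx => by
    rw [mem_primePowBall_iff, zpow_neg, zpow_natCast, inv_pow, inv_inv]
    exact le_trans hx hk.le
  exact (isCompact_primePowBall _).of_isClosed_subset (isClosed_le LocalFieldHaar.continuous_normAbs continuous_const) hsub

variable [MeasurableSpace E] [BorelSpace E]

omit [Invertible (2 : E)] in
/-- `hmul` for `nrm = normAbs E`: `‖u b‖ = ‖u‖_E · ‖b‖` with `‖u‖_E = distribHaarChar E u` (★ F2 `distribHaarChar_eq_normAbs'`). [cite: Tate1950, §2.2, Lemma 2.2.5] -/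
theorem normAbs_units_mul (u : Eˣ) (b : E) : normAbs E ((u : E) * b) = distribHaarChar E u * normAbs E b := by
  rw [map_mul, distribHaarChar_eq_normAbs']

variable [T2Space E] [SecondCountableTopology E]

include hσ hσc hσn in
/-- **`μ⁺{0} = 0`**: `{0} ⊆ E⁺` is its own preimage under the scaling by a fixed unit `l` of norm `> 1`, whose module `χ⁺(l) = χ⁻(l) > 1` is not `1`, while `μ⁺{0} < ∞`.
[cite: WeilBNT1967, Ch. I §2] -/
theorem measure_singleton_zero_fixedPart (δ : Eˣ) (hδ : σ (δ : E) = -δ) (μp : Measure (fixedPart σ)) [μp.IsAddHaarMeasure] [μp.Regular] :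
    μp {0} = 0 := by
  haveI := locallyCompactSpace_fixedPart σ hσc
  haveI : SecondCountableTopology (fixedPart σ) := TopologicalSpace.Subtype.secondCountableTopology _
  obtain ⟨l₀, hl₀, hQ₀⟩ := exists_fixed_one_lt_normAbs σ hσ hσn
  have hl₀0 : l₀ ≠ 0 := fun h => by rw [h, map_zero] at hQ₀; exact not_lt_of_ge zero_le hQ₀
  set l : Eˣ := Units.mk0 l₀ hl₀0 with hldef
  have hl : σ (l : E) = l := hl₀
  have hm1 : 1 < fixedModulus σ hσc l hl := by
    rw [fixedModulus_eq_skewModulus σ hσc δ hδ l hl]; exact one_lt_skewModulus σ hσ hσc δ hδ l hl hQ₀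
  have hpre : (smulFixed σ l hl) ⁻¹' ({0} : Set (fixedPart σ)) = {0} := by
    ext y
    simp only [Set.mem_preimage, Set.mem_singleton_iff]
    constructor
    · intro h
      have h' : ((smulFixed σ l hl y : fixedPart σ) : E) = 0 := by rw [h]; rfl
      rw [coe_smulFixed] at h'
      exact Subtype.ext ((mul_eq_zero.1 h').resolve_left l.ne_zero)
    · intro h; rw [h]; exact Subtype.ext (by rw [coe_smulFixed]; exact mul_zero _)
  have hms : Measurable (smulFixed σ l hl : fixedPart σ → fixedPart σ) := (smulFixed σ l hl).continuous.measurable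
  have h1 : μp {0} = ((fixedModulus σ hσc l hl)⁻¹ : ℝ≥0) * μp {0} := by
    conv_lhs => rw [← hpre, ← Measure.map_apply hms (measurableSet_singleton 0), map_smulFixed_eq σ hσc l hl μp, Measure.coe_nnreal_smul_apply]
  have hfin : μp {0} ≠ ⊤ := (measure_singleton_lt_top (μ := μp) (a := (0 : fixedPart σ))).ne
  by_contra h0
  have hc : (((fixedModulus σ hσc l hl)⁻¹ : ℝ≥0) : ℝ≥0∞) < 1 := by rw [ENNReal.coe_lt_one_iff]; exact inv_lt_one_of_one_lt₀ hm1
  have hlt : (((fixedModulus σ hσc l hl)⁻¹ : ℝ≥0) : ℝ≥0∞) * μp {0} < 1 * μp {0} := ENNReal.mul_lt_mul_left h0 hfin hc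
  rw [one_mul] at hlt
  exact absurd h1 hlt.ne'

include hσ hσc hσn in
/-- **Almost every `s ∈ E⁺` is non-zero (a unit).** [cite: WeilBNT1967, Ch. I §2] -/
theorem ae_ne_zero_fixedPart (δ : Eˣ) (hδ : σ (δ : E) = -δ) (μp : Measure (fixedPart σ)) [μp.IsAddHaarMeasure] [μp.Regular] :
    ∀ᵐ s ∂μp, ((s : fixedPart σ) : E) ≠ 0 := by
  rw [ae_iff]
  have h : {s : fixedPart σ | ¬ ((s : E) ≠ 0)} = {0} := by
    ext s; simp only [ne_eq, not_not, Set.mem_setOf_eq, Set.mem_singleton_iff]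
    exact ⟨fun h => Subtype.ext h, fun h => by rw [h]; rfl⟩
  rw [h]
  exact measure_singleton_zero_fixedPart σ hσ hσc hσn δ hδ μp

end Prelim

/-! ## §2 The fibre over a unit `s ∈ E⁺`, and the fibration of the truncated zeta integral -/

section Fibration

variable [MeasurableSpace E] [BorelSpace E] [T2Space E] [SecondCountableTopology E]
  (μp : Measure (fixedPart σ)) [μp.IsAddHaarMeasure] [μp.Regular] (μm : Measure (skewPart σ)) [μm.IsAddHaarMeasure] [μm.Regular]

include hσ hσc in
/-- **THE FIBRE OVER A UNIT `s ∈ E⁺`.**  By the substitution `y = s η` (module `χ⁻(s)`, ★ B2 (i)), `Re(s(1+η)) = s`, `Im(s(1+η)) = sη`, `D(s(1+η)) = D(s)D(1+η)`,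
`‖s(1+η)‖ = ‖s‖‖1+η‖` and `χ⁻(s)‖s‖⁻¹ = (√‖s‖)⁻¹`:
`∫_{E⁻} Φ(Re(s+y)) 𝟙[‖Im(s+y)‖ ≤ T] D(s+y) ‖s+y‖⁻¹ dμ⁻(y) = Φ(s) D(s) (√‖s‖)⁻¹ · ∫_{E⁻} 𝟙[‖η‖ ≤ T/‖s‖] (‖1+η‖⁻¹ • D(1+η)) dμ⁻(η)`.
[cite: Tate1950, §2.2, Lemma 2.2.5] [cite: WeilBNT1967, Ch. VII §2] -/
theorem integral_fibre_truncTest_mul (δ : Eˣ) (hδ : σ (δ : E) = -δ)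
    (Φ D : E → ℂ) (hD : ∀ a b, D (a * b) = D a * D b) (T : ℝ≥0) (s : fixedPart σ) (hs : (s : E) ≠ 0) :
    ∫ y : skewPart σ, Φ (⅟(2 : E) * (((s : E) + (y : E)) + σ ((s : E) + (y : E)))) *
        ({y : E | normAbs E y ≤ T}.indicator (fun _ => (1 : ℂ)) (⅟(2 : E) * (((s : E) + (y : E)) - σ ((s : E) + (y : E))))) *
        (D ((s : E) + (y : E)) * ((((normAbs E ((s : E) + (y : E)) : ℝ≥0) : ℝ) : ℂ))⁻¹) ∂μm =
      (Φ (s : E) * D (s : E) * ((((NNReal.sqrt (normAbs E (s : E)))⁻¹ : ℝ≥0) : ℝ) : ℂ)) *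
        ∫ η, ({η : skewPart σ | normAbs E (η : E) ≤ T / normAbs E (s : E)}.indicator
          (fun η : skewPart σ => (((normAbs E (1 + (η : E)))⁻¹ : ℝ≥0)) • D (1 + (η : E)))) η ∂μm := by
  haveI := locallyCompactSpace_skewPart σ hσc
  haveI : SecondCountableTopology (skewPart σ) := TopologicalSpace.Subtype.secondCountableTopology _
  set u : Eˣ := Units.mk0 (s : E) hs with hudef
  have hu : σ (u : E) = u := s.2
  have hs' : σ (s : E) = s := s.2
  have hns : 0 < normAbs E (s : E) := pos_iff_ne_zero.2 ((map_ne_zero _).2 hs)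
  rw [integral_eq_skewModulus_smul_integral_comp_smulSkew σ hσc μm u hu]
  -- the pointwise identity in the fibre
  have hpt : ∀ η : skewPart σ,
      Φ (⅟(2 : E) * (((s : E) + ((smulSkew σ u hu η : skewPart σ) : E)) + σ ((s : E) + ((smulSkew σ u hu η : skewPart σ) : E)))) *
        ({y : E | normAbs E y ≤ T}.indicator (fun _ => (1 : ℂ))
          (⅟(2 : E) * (((s : E) + ((smulSkew σ u hu η : skewPart σ) : E)) - σ ((s : E) + ((smulSkew σ u hu η : skewPart σ) : E))))) *
        (D ((s : E) + ((smulSkew σ u hu η : skewPart σ) : E)) *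
          ((((normAbs E ((s : E) + ((smulSkew σ u hu η : skewPart σ) : E)) : ℝ≥0) : ℝ) : ℂ))⁻¹) =
      (Φ (s : E) * D (s : E) * ((((normAbs E (s : E) : ℝ≥0) : ℝ) : ℂ))⁻¹) *
        ({η : skewPart σ | normAbs E (η : E) ≤ T / normAbs E (s : E)}.indicator
          (fun η : skewPart σ => (((normAbs E (1 + (η : E)))⁻¹ : ℝ≥0)) • D (1 + (η : E)))) η := by
    intro η
    have hη : σ (η : E) = -(η : E) := (mem_skewPart_iff σ _).1 η.2
    have hcoe : ((smulSkew σ u hu η : skewPart σ) : E) = (s : E) * (η : E) := by rw [coe_smulSkew]; rfl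
    rw [hcoe, re_fibre σ hs' hη, im_fibre σ hs' hη, show (s : E) + (s : E) * (η : E) = (s : E) * (1 + (η : E)) by ring, hD, map_mul]
    by_cases hmem : normAbs E (η : E) ≤ T / normAbs E (s : E)
    · have hmem' : (s : E) * (η : E) ∈ {y : E | normAbs E y ≤ T} := by
        show normAbs E ((s : E) * (η : E)) ≤ T
        rw [map_mul, mul_comm]; exact (le_div_iff₀ hns).1 hmem
      rw [Set.indicator_of_mem hmem', Set.indicator_of_mem (show η ∈ {η : skewPart σ | normAbs E (η : E) ≤ T / normAbs E (s : E)} from hmem),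
        NNReal.smul_def, Complex.real_smul]
      push_cast
      ring
    · have hmem' : (s : E) * (η : E) ∉ {y : E | normAbs E y ≤ T} := by
        intro h
        have h' : normAbs E ((s : E) * (η : E)) ≤ T := h
        rw [map_mul, mul_comm] at h'
        exact hmem ((le_div_iff₀ hns).2 h')
      rw [Set.indicator_of_notMem hmem', Set.indicator_of_notMem (show η ∉ {η : skewPart σ | normAbs E (η : E) ≤ T / normAbs E (s : E)} from hmem)]
      ring
  simp_rw [hpt]
  rw [integral_const_mul, Complex.real_smul, ← mul_assoc]
  congr 1
  -- `χ⁻(s) · ‖s‖⁻¹ = (√‖s‖)⁻¹`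
  have hd : skewModulus σ hσc u hu * (normAbs E (u : E))⁻¹ = (NNReal.sqrt (normAbs E (u : E)))⁻¹ :=
    skewModulus_mul_inv_nrm σ hσ hσc (normAbs_units_mul (E := E)) (map_one (normAbs E)) δ hδ u hu
  have hu' : (u : E) = (s : E) := rfl
  rw [hu'] at hd
  have hd' : ((skewModulus σ hσc u hu : ℝ) : ℂ) * ((((normAbs E (s : E) : ℝ≥0) : ℝ) : ℂ))⁻¹ =
      ((((NNReal.sqrt (normAbs E (s : E)))⁻¹ : ℝ≥0) : ℝ) : ℂ) := by
    rw [← hd]; push_cast; ring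
  rw [← hd']
  ring

omit [MeasurableSpace E] [BorelSpace E] [T2Space E] [SecondCountableTopology E] in
include hσn in
/-- The integrand of the truncated zeta integral is bounded: `‖Φ(Re x) 𝟙[‖Im x‖ ≤ T] D(x) ‖x‖⁻¹‖ ≤ C_Φ · C · (‖2‖ ε)⁻¹` (if `Φ(Re x) ≠ 0` then `‖Re x‖ ≥ ε`, so `‖x‖ ≥ ‖2‖ ε` by
★ F2 `normAbs_le_half_mul_of_fixed`). [cite: WeilBNT1967, Ch. I §2] -/
theorem norm_truncTest_mul_le (Φ : E → ℂ) {CΦ : ℝ} (hΦb : ∀ a, ‖Φ a‖ ≤ CΦ) {ε : ℝ≥0} (hε : 0 < ε) (hΦ0 : ∀ a, normAbs E a < ε → Φ a = 0)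
    (D : E → ℂ) {C : ℝ} (hDb : ∀ b, ‖D b‖ ≤ C) (T : ℝ≥0) (a y : E) (ha : σ a = a) (hy : σ y = -y) :
    ‖Φ (⅟(2 : E) * ((a + y) + σ (a + y))) * ({y : E | normAbs E y ≤ T}.indicator (fun _ => (1 : ℂ)) (⅟(2 : E) * ((a + y) - σ (a + y)))) *
        (D (a + y) * ((((normAbs E (a + y) : ℝ≥0) : ℝ) : ℂ))⁻¹)‖ ≤ CΦ * C * (((normAbs E 2 * ε)⁻¹ : ℝ≥0) : ℝ) := by
  have hC : 0 ≤ C := le_trans (norm_nonneg _) (hDb 0)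
  have hCΦ : 0 ≤ CΦ := le_trans (norm_nonneg _) (hΦb 0)
  rw [re_add σ ha hy, im_add σ ha hy]
  by_cases hΦa : Φ a = 0
  · rw [hΦa, zero_mul, zero_mul, norm_zero]; positivity
  · have hεa : ε ≤ normAbs E a := by
      by_contra h; push Not at h; exact hΦa (hΦ0 a h)
    have hlow : normAbs E 2 * ε ≤ normAbs E (a + y) := by
      have h1 := normAbs_le_half_mul_of_fixed σ hσn ha hy
      calc normAbs E 2 * ε ≤ normAbs E 2 * (normAbs E (⅟(2 : E)) * normAbs E (a + y)) := mul_le_mul_of_nonneg_left (le_trans hεa h1) zero_le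
        _ = normAbs E (a + y) := by rw [← mul_assoc, mul_comm (normAbs E 2), normAbs_invOf_two_mul_normAbs_two, one_mul]
    have hpos : 0 < normAbs E 2 * ε := mul_pos normAbs_two_pos hε
    have hinv : ‖((((normAbs E (a + y) : ℝ≥0) : ℝ) : ℂ))⁻¹‖ ≤ (((normAbs E 2 * ε)⁻¹ : ℝ≥0) : ℝ) := by
      rw [norm_inv, Complex.norm_real, Real.norm_of_nonneg (NNReal.coe_nonneg _), ← NNReal.coe_inv, NNReal.coe_le_coe]
      exact inv_anti₀ hpos hlow
    have hind : ‖({y : E | normAbs E y ≤ T}.indicator (fun _ => (1 : ℂ)) y)‖ ≤ 1 := by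
      by_cases h : y ∈ {y : E | normAbs E y ≤ T}
      · rw [Set.indicator_of_mem h, norm_one]
      · rw [Set.indicator_of_notMem h, norm_zero]; exact zero_le_one
    calc ‖Φ a * ({y : E | normAbs E y ≤ T}.indicator (fun _ => (1 : ℂ)) y) * (D (a + y) * ((((normAbs E (a + y) : ℝ≥0) : ℝ) : ℂ))⁻¹)‖
        = ‖Φ a‖ * ‖({y : E | normAbs E y ≤ T}.indicator (fun _ => (1 : ℂ)) y)‖ * (‖D (a + y)‖ * ‖((((normAbs E (a + y) : ℝ≥0) : ℝ) : ℂ))⁻¹‖) := by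
          rw [norm_mul, norm_mul, norm_mul]
      _ ≤ CΦ * 1 * (C * (((normAbs E 2 * ε)⁻¹ : ℝ≥0) : ℝ)) :=
          mul_le_mul (mul_le_mul (hΦb a) hind (norm_nonneg _) hCΦ) (mul_le_mul (hDb _) hinv (norm_nonneg _) hC)
            (mul_nonneg (norm_nonneg _) (norm_nonneg _)) (mul_nonneg hCΦ zero_le_one)
      _ = CΦ * C * (((normAbs E 2 * ε)⁻¹ : ℝ≥0) : ℝ) := by ring

omit [μp.Regular] [μm.Regular] in
include hσc hσn in
/-- **Integrability on `E⁺ × E⁻`** of `(s, y) ↦ Φ(Re(s+y)) 𝟙[‖Im(s+y)‖ ≤ T] D(s+y) ‖s+y‖⁻¹`: bounded (above) with support in the compact `{‖s‖ ≤ R} × {‖y‖ ≤ T}`.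
[cite: WeilBNT1967, Ch. II §5] -/
theorem integrable_truncTest_mul_prod
    (Φ : E → ℂ) (hΦm : Measurable Φ) {CΦ : ℝ} (hΦb : ∀ a, ‖Φ a‖ ≤ CΦ) {ε : ℝ≥0} (hε : 0 < ε) (hΦ0 : ∀ a, normAbs E a < ε → Φ a = 0)
    {R : ℝ≥0} (hΦR : ∀ a, R < normAbs E a → Φ a = 0)
    (D : E → ℂ) (hDm : Measurable D) {C : ℝ} (hDb : ∀ b, ‖D b‖ ≤ C) (T : ℝ≥0) :
    Integrable (fun p : fixedPart σ × skewPart σ =>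
      Φ (⅟(2 : E) * ((((p.1 : fixedPart σ) : E) + ((p.2 : skewPart σ) : E)) + σ (((p.1 : fixedPart σ) : E) + ((p.2 : skewPart σ) : E)))) *
        ({y : E | normAbs E y ≤ T}.indicator (fun _ => (1 : ℂ))
          (⅟(2 : E) * ((((p.1 : fixedPart σ) : E) + ((p.2 : skewPart σ) : E)) - σ (((p.1 : fixedPart σ) : E) + ((p.2 : skewPart σ) : E))))) *
        (D (((p.1 : fixedPart σ) : E) + ((p.2 : skewPart σ) : E)) *
          ((((normAbs E (((p.1 : fixedPart σ) : E) + ((p.2 : skewPart σ) : E)) : ℝ≥0) : ℝ) : ℂ))⁻¹)) (μp.prod μm) := by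
  haveI := locallyCompactSpace_fixedPart σ hσc
  haveI := locallyCompactSpace_skewPart σ hσc
  haveI : SecondCountableTopology (fixedPart σ) := TopologicalSpace.Subtype.secondCountableTopology _
  haveI : SecondCountableTopology (skewPart σ) := TopologicalSpace.Subtype.secondCountableTopology _
  -- the integrand on `E` and its measurability
  set G : E → ℂ := fun x => Φ (⅟(2 : E) * (x + σ x)) * ({y : E | normAbs E y ≤ T}.indicator (fun _ => (1 : ℂ)) (⅟(2 : E) * (x - σ x))) *
    (D x * ((((normAbs E x : ℝ≥0) : ℝ) : ℂ))⁻¹) with hGdef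
  have hball : MeasurableSet {y : E | normAbs E y ≤ T} := measurableSet_le LocalFieldHaar.continuous_normAbs.measurable measurable_const
  have hGm : Measurable G := by
    refine ((hΦm.comp (measurable_const.mul (measurable_id.add hσc.measurable))).mul
      ((measurable_const.indicator hball).comp (measurable_const.mul (measurable_id.sub hσc.measurable)))).mul (hDm.mul ?_)
    exact (Complex.measurable_ofReal.comp (NNReal.continuous_coe.measurable.comp LocalFieldHaar.continuous_normAbs.measurable)).inv
  have hsum : Measurable fun p : fixedPart σ × skewPart σ => ((p.1 : fixedPart σ) : E) + ((p.2 : skewPart σ) : E) :=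
    (measurable_subtype_coe.comp measurable_fst).add (measurable_subtype_coe.comp measurable_snd)
  have hGPm : Measurable fun p : fixedPart σ × skewPart σ => G (((p.1 : fixedPart σ) : E) + ((p.2 : skewPart σ) : E)) := hGm.comp hsum
  -- the support
  set S : Set (fixedPart σ × skewPart σ) := {s : fixedPart σ | normAbs E (s : E) ≤ R} ×ˢ {y : skewPart σ | normAbs E (y : E) ≤ T} with hSdef
  have hnp : Continuous fun s : fixedPart σ => normAbs E (s : E) := LocalFieldHaar.continuous_normAbs.comp continuous_subtype_val
  have hnm : Continuous fun y : skewPart σ => normAbs E (y : E) := LocalFieldHaar.continuous_normAbs.comp continuous_subtype_val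
  have hSm : MeasurableSet S := (measurableSet_le hnp.measurable measurable_const).prod (measurableSet_le hnm.measurable measurable_const)
  have hSfin : (μp.prod μm) S < ⊤ := by
    rw [hSdef, Measure.prod_prod]
    refine ENNReal.mul_lt_top ?_ ?_
    · exact ((isClosed_fixedPart σ hσc).isClosedEmbedding_subtypeVal.isCompact_preimage (isCompact_setOf_normAbs_le R)).measure_lt_top
    · exact ((isClosed_skewPart σ hσc).isClosedEmbedding_subtypeVal.isCompact_preimage (isCompact_setOf_normAbs_le T)).measure_lt_top
  have hsupp : ∀ p : fixedPart σ × skewPart σ, p ∉ S → G (((p.1 : fixedPart σ) : E) + ((p.2 : skewPart σ) : E)) = 0 := by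
    rintro ⟨s, y⟩ hp
    have hs' : σ (s : E) = s := s.2
    have hy' : σ (y : E) = -(y : E) := (mem_skewPart_iff σ _).1 y.2
    simp only [hGdef]
    rw [re_add σ hs' hy', im_add σ hs' hy']
    rw [hSdef, Set.mem_prod, not_and_or] at hp
    rcases hp with h | h
    · have h' : R < normAbs E (s : E) := lt_of_not_ge h
      rw [hΦR _ h', zero_mul, zero_mul]
    · rw [Set.indicator_of_notMem (show (y : E) ∉ {y : E | normAbs E y ≤ T} from h), mul_zero, zero_mul]
  have hind : (fun p : fixedPart σ × skewPart σ => G (((p.1 : fixedPart σ) : E) + ((p.2 : skewPart σ) : E))) =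
      S.indicator (fun p : fixedPart σ × skewPart σ => G (((p.1 : fixedPart σ) : E) + ((p.2 : skewPart σ) : E))) := by
    funext p
    by_cases hp : p ∈ S
    · rw [Set.indicator_of_mem hp]
    · rw [Set.indicator_of_notMem hp, hsupp p hp]
  have hbd : ∀ p : fixedPart σ × skewPart σ, ‖G (((p.1 : fixedPart σ) : E) + ((p.2 : skewPart σ) : E))‖ ≤ CΦ * C * (((normAbs E 2 * ε)⁻¹ : ℝ≥0) : ℝ) :=
    fun p => norm_truncTest_mul_le σ hσn Φ hΦb hε hΦ0 D hDb T _ _ p.1.2 ((mem_skewPart_iff σ _).1 p.2.2)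
  have hint : IntegrableOn (fun p : fixedPart σ × skewPart σ => G (((p.1 : fixedPart σ) : E) + ((p.2 : skewPart σ) : E))) S (μp.prod μm) :=
    Measure.integrableOn_of_bounded hSfin.ne hGPm.aestronglyMeasurable (Eventually.of_forall hbd)
  change Integrable (fun p : fixedPart σ × skewPart σ => G (((p.1 : fixedPart σ) : E) + ((p.2 : skewPart σ) : E))) (μp.prod μm)
  rw [hind]
  exact (integrable_indicator_iff hSm).2 hint

omit [μp.Regular] [μm.Regular] in
include hσn in
/-- **THE ZETA INTEGRAL OVER `E` AS AN ITERATED INTEGRAL OVER `E⁺ × E⁻`** (`μ_E = (μ⁺ ⊗ μ⁻) ∘ ringDecomp⁻¹`, Fubini for the integrable integrand above).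
[cite: WeilBNT1967, Ch. VII §2] -/
theorem integral_truncTest_mul_eq_integral_integral
    (Φ : E → ℂ) (hΦm : Measurable Φ) {CΦ : ℝ} (hΦb : ∀ a, ‖Φ a‖ ≤ CΦ) {ε : ℝ≥0} (hε : 0 < ε) (hΦ0 : ∀ a, normAbs E a < ε → Φ a = 0)
    {R : ℝ≥0} (hΦR : ∀ a, R < normAbs E a → Φ a = 0)
    (D : E → ℂ) (hDm : Measurable D) {C : ℝ} (hDb : ∀ b, ‖D b‖ ≤ C) (T : ℝ≥0) :
    ∫ x, Φ (⅟(2 : E) * (x + σ x)) * ({y : E | normAbs E y ≤ T}.indicator (fun _ => (1 : ℂ)) (⅟(2 : E) * (x - σ x))) *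
        (D x * ((((normAbs E x : ℝ≥0) : ℝ) : ℂ))⁻¹) ∂((μp.prod μm).map (ringDecomp σ hσ hσc).symm) =
      ∫ s : fixedPart σ, ∫ y : skewPart σ, Φ (⅟(2 : E) * (((s : E) + (y : E)) + σ ((s : E) + (y : E)))) *
        ({y : E | normAbs E y ≤ T}.indicator (fun _ => (1 : ℂ)) (⅟(2 : E) * (((s : E) + (y : E)) - σ ((s : E) + (y : E))))) *
        (D ((s : E) + (y : E)) * ((((normAbs E ((s : E) + (y : E)) : ℝ≥0) : ℝ) : ℂ))⁻¹) ∂μm ∂μp := by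
  haveI := locallyCompactSpace_fixedPart σ hσc
  haveI := locallyCompactSpace_skewPart σ hσc
  haveI : SecondCountableTopology (fixedPart σ) := TopologicalSpace.Subtype.secondCountableTopology _
  haveI : SecondCountableTopology (skewPart σ) := TopologicalSpace.Subtype.secondCountableTopology _
  set e := ringDecomp σ hσ hσc with he
  set meq : fixedPart σ × skewPart σ ≃ᵐ E := e.symm.toHomeomorph.toMeasurableEquiv with hmeq
  have hμ : ((μp.prod μm).map (ringDecomp σ hσ hσc).symm) = (μp.prod μm).map meq := rfl
  rw [hμ, integral_map_equiv meq]
  exact integral_prod _ (integrable_truncTest_mul_prod σ hσc hσn μp μm Φ hΦm hΦb hε hΦ0 hΦR D hDm hDb T)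

include hσn in
/-- **THE FIBRATION `x = s(1+η)` OF THE TRUNCATED ZETA INTEGRAL.**  For bounded measurable `Φ, D : E → ℂ` with `D` multiplicative, `Φ = 0` on `{‖a‖ < ε}` and off
`{‖a‖ ≤ R}`, a `σ`-skew unit `δ`, and `T ≥ 0`:
`∫_E Φ(½(x+σx)) 𝟙[‖½(x−σx)‖ ≤ T] D(x) ‖x‖⁻¹ dμ_E = ∫_{E⁺} Φ(s) D(s) (√‖s‖)⁻¹ · (∫_{E⁻} 𝟙[‖η‖ ≤ T/‖s‖] (‖1+η‖⁻¹ • D(1+η)) dμ⁻) dμ⁺(s)`, `μ_E = (μ⁺ ⊗ μ⁻) ∘ ringDecomp⁻¹`.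
[cite: Keys1984, §5] [cite: Tate1950, §2.2, Lemma 2.2.5] [cite: WeilBNT1967, Ch. VII §2] -/
theorem integral_truncTest_mul_eq_integral_fixedPart (δ : Eˣ) (hδ : σ (δ : E) = -δ)
    (Φ : E → ℂ) (hΦm : Measurable Φ) {CΦ : ℝ} (hΦb : ∀ a, ‖Φ a‖ ≤ CΦ) {ε : ℝ≥0} (hε : 0 < ε) (hΦ0 : ∀ a, normAbs E a < ε → Φ a = 0)
    {R : ℝ≥0} (hΦR : ∀ a, R < normAbs E a → Φ a = 0)
    (D : E → ℂ) (hDm : Measurable D) {C : ℝ} (hDb : ∀ b, ‖D b‖ ≤ C) (hD : ∀ a b, D (a * b) = D a * D b) (T : ℝ≥0) :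
    ∫ x, Φ (⅟(2 : E) * (x + σ x)) * ({y : E | normAbs E y ≤ T}.indicator (fun _ => (1 : ℂ)) (⅟(2 : E) * (x - σ x))) *
        (D x * ((((normAbs E x : ℝ≥0) : ℝ) : ℂ))⁻¹) ∂((μp.prod μm).map (ringDecomp σ hσ hσc).symm) =
      ∫ s : fixedPart σ, (Φ (s : E) * D (s : E) * ((((NNReal.sqrt (normAbs E (s : E)))⁻¹ : ℝ≥0) : ℝ) : ℂ)) *
        (∫ η, ({η : skewPart σ | normAbs E (η : E) ≤ T / normAbs E (s : E)}.indicator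
          (fun η : skewPart σ => (((normAbs E (1 + (η : E)))⁻¹ : ℝ≥0)) • D (1 + (η : E)))) η ∂μm) ∂μp := by
  rw [integral_truncTest_mul_eq_integral_integral σ hσ hσc hσn μp μm Φ hΦm hΦb hε hΦ0 hΦR D hDm hDb T]
  refine integral_congr_ae ?_
  filter_upwards [ae_ne_zero_fixedPart σ hσ hσc hσn δ hδ μp] with s hs
  exact integral_fibre_truncTest_mul σ hσ hσc μm δ hδ Φ D hD T s hs

end Fibration

end Summit.HodgeConjecture.HodgeConjecture.Cruxes.H413.K2E3SkewLineZetaFibration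

end
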